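import Summits.SmoothPoincare4.SmoothPoincare4.Theorems.ConvexBisectionAcyclicBisectionExistsEOneCurveChart
import Summits.SmoothPoincare4.SmoothPoincare4.Theorems.ConvexBisectionAcyclicBisectionExistsEOneCurveSheetLoop
import HarnessLib

/-!
# The radial segment of the annulus chart of the `e_1`-curve: the sign of its sheet, exclusions
(wave 7, brick H5-5a of the last geometric input (R-E1CURVE) of node N3a `node_STcurve` of stub
`stub_STgeo` = NF4 N3, line `modp-braid-orbits`, crux `ConvexBisection.AcyclicBisectionExists`,
item stmt-SmoothPoincare4-10508; registered sub-goal `helper_eOne_radial_sign`)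

Tools for the evaluation of the crossing number of OUR chart `φ = eoChart hg` (round circles
`‖x − c₀‖ = eoRadP r`, explicit sheet `eoY`) with the radial vanishing cycle of
`…EOneCurveSheetLoop.lean`:

* §1 on the radial segment `r ↦ eoX g (u⋆, r)` of the chart along the ray through `ζ_4`
  (`e^{2πiu⋆} = eoDir g`, `exists_phase_eoDir`), which lies in the open unit disc, the chart sheet is
  `eoY = σ √(x^{2g+1}+1)` for ONE sign `σ = ±1` (two continuous square roots of a non-vanishing function
  on a segment, `IsPreconnected.eq_or_eq_neg_of_sq_eq`) — **`helper_eOne_radial_sign`**;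
* §2 exclusion principles: a point whose `x`-coordinate `λ x'` has `‖x' − c₀‖` off
  `[eoRadP (1/2), eoRadP (−1/2)]` is off the closed collar (E1); a point on the OTHER sheet `−eoY` over a
  point of the annulus is off the whole chart (E2).

Everything is proved; no `sorry`.  References: J. Milnor, *Singular points of complex hypersurfaces*
(1968), §9 [Milnor1968].
-/

noncomputable section

set_option linter.dupNamespace false

open scoped Manifold ContDiff Topology ComplexConjugate Real
open Set Function Metric Complex
open Literature.Topology.FourManifolds Literature.Topology.FourManifolds.LefschetzBase
  Literature.Topology.FourManifolds.TorusKnotMilnor Literature.GroupTheory.CombinatorialGroupTheory.SignedHurwitz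

namespace Summit.SmoothPoincare4.SmoothPoincare4.Theorems.AcyclicBisectionExists.ModpBraidOrbits

variable {g : ℕ}

/-! ## §1 The radial segment of the chart and the sign of its sheet -/

/-- The direction `d` is a phase: `e^{2πiu⋆} = d` for some `u⋆`. [folklore] -/
theorem exists_phase_eoDir (hg : 2 ≤ g) : ∃ u : ℝ, cexp (((2 * π * u : ℝ) : ℂ) * I) = eoDir g := by
  refine ⟨Complex.arg (eoDir g) / (2 * π), ?_⟩
  have h := Complex.norm_mul_exp_arg_mul_I (eoDir g)
  rw [norm_eoDir hg, Complex.ofReal_one, one_mul] at h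
  have e : (((2 * π * (Complex.arg (eoDir g) / (2 * π)) : ℝ)) : ℂ) * I = (Complex.arg (eoDir g) : ℂ) * I := by
    congr 1; push_cast; field_simp
  rw [e, h]

variable {u : ℝ}

/-- On the phase `u⋆` the chart `x`-coordinate is the ray point `c₀ + eoRadP r · d`. [folklore] -/
theorem eoX_ray (hu : cexp (((2 * π * u : ℝ) : ℂ) * I) = eoDir g) (r : ℝ) :
    eoX g (u, r) = eoCenter g + (eoRadP g r : ℂ) * eoDir g := by
  rw [eoX, hu]

/-- **Ray points strictly inside the ray segment lie in the open unit disc.** [folklore] -/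
theorem norm_ray_lt_one (hg : 2 ≤ g) {ρ : ℝ} (h0 : 0 ≤ ρ) (h1 : ρ < ‖branchPt g 4 - eoCenter g‖) :
    ‖eoCenter g + (ρ : ℂ) * eoDir g‖ < 1 := by
  have h := norm_ray_le hg h0 h1.le
  have : 0 < 1 - ρ / ‖branchPt g 4 - eoCenter g‖ := by
    rw [sub_pos, div_lt_one (norm_four_sub_center_pos hg)]; exact h1
  linarith

/-- The chart radii are ray radii strictly inside the segment: `0 ≤ eoRadP r < ‖ζ_4 − c₀‖`. [folklore] -/
theorem eoRadP_lt_norm_four (hg : 2 ≤ g) (r : ℝ) : 0 ≤ eoRadP g r ∧ eoRadP g r < ‖branchPt g 4 - eoCenter g‖ := by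
  have h := eoRadP_mem (by omega : 1 ≤ g) r
  have := norm_four_sub_center_gt hg; have := (eoKap_bounds hg).1
  exact ⟨(eoRadP_pos hg r).le, by linarith [h.2]⟩

/-- **The chart sheet on the radial segment is `σ √` for one sign `σ = ±1`.** [folklore] -/
theorem exists_sign_radial (hg : 2 ≤ g) (hu : cexp (((2 * π * u : ℝ) : ℂ) * I) = eoDir g) :
    ∃ σ : ℂ, (σ = 1 ∨ σ = -1) ∧ ∀ r ∈ Icc (-1 : ℝ) 1,
      eoY g (eoX g (u, r)) = σ * csqrt (eoX g (u, r) ^ (2 * g + 1) + 1) := by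
  have hX : Continuous fun r : ℝ => eoX g (u, r) := (contDiff_eoX g).continuous.comp (by fun_prop)
  have hlt : ∀ r : ℝ, ‖eoX g (u, r)‖ < 1 := fun r => by
    rw [eoX_ray hu]; exact norm_ray_lt_one hg (eoRadP_lt_norm_four hg r).1 (eoRadP_lt_norm_four hg r).2
  have hf : ContinuousOn (fun r : ℝ => eoY g (eoX g (u, r))) (Icc (-1 : ℝ) 1) := fun r _ =>
    (ContinuousAt.comp (g := eoY g) (f := fun r : ℝ => eoX g (u, r))
      (contDiffAt_eoY hg (eoX_mem_ann hg (u, r)).1 (eoX_mem_ann hg (u, r)).2).continuousAt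
      hX.continuousAt).continuousWithinAt
  have hgc : ContinuousOn (fun r : ℝ => csqrt (eoX g (u, r) ^ (2 * g + 1) + 1)) (Icc (-1 : ℝ) 1) := fun r _ =>
    (ContinuousAt.comp (g := csqrt) (f := fun r : ℝ => eoX g (u, r) ^ (2 * g + 1) + 1)
      (continuousAt_csqrt (re_pow_add_one_nonneg g (hlt r).le)) ((hX.pow _).add continuous_const).continuousAt).continuousWithinAt
  have hsq : EqOn ((fun r : ℝ => eoY g (eoX g (u, r))) ^ 2) ((fun r : ℝ => csqrt (eoX g (u, r) ^ (2 * g + 1) + 1)) ^ 2)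
      (Icc (-1 : ℝ) 1) := fun r _ => by
    simp only [Pi.pow_apply]; rw [eoY_eoX_sq hg, csqrt_sq]
  have hne : ∀ {r : ℝ}, r ∈ Icc (-1 : ℝ) 1 → csqrt (eoX g (u, r) ^ (2 * g + 1) + 1) ≠ 0 := fun {r} _ =>
    csqrt_ne_zero (pow_add_one_ne_zero_of_norm_lt (hlt r))
  rcases isPreconnected_Icc.eq_or_eq_neg_of_sq_eq hf hgc hsq hne with h | h
  · refine ⟨1, Or.inl rfl, fun r hr => ?_⟩
    have e := h hr
    beta_reduce at e
    rw [e, one_mul]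
  · refine ⟨-1, Or.inr rfl, fun r hr => ?_⟩
    have e := h hr
    simp only [Pi.neg_apply] at e
    rw [e, neg_one_mul]

/-! ## §2 Exclusion principles for the chart -/

variable {hg : 2 ≤ g}

/-- `eoRadP (1/2) ≤ eoRadP r ≤ eoRadP (−1/2)` for `|r| ≤ 1/2`. [folklore] -/
theorem eoRadP_mem_of_abs_le (hg1 : 1 ≤ g) {r : ℝ} (hr : r ∈ Icc (-(1 / 2) : ℝ) (1 / 2)) :
    eoRadP g (1 / 2) ≤ eoRadP g r ∧ eoRadP g r ≤ eoRadP g (-(1 / 2)) := by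
  have hr' : r ∈ Icc (-1 : ℝ) 1 := ⟨by linarith [hr.1], by linarith [hr.2]⟩
  exact ⟨(strictAntiOn_eoRadP hg1).antitoneOn hr' ⟨by norm_num, by norm_num⟩ hr.2,
    (strictAntiOn_eoRadP hg1).antitoneOn ⟨by norm_num, by norm_num⟩ hr' hr.1⟩

/-- **(E1)** A point whose `x`-coordinate `λ x'` has `‖x' − c₀‖` off `[eoRadP (1/2), eoRadP (−1/2)]` is
off the closed collar. [folklore] -/
theorem not_mem_collar_of_radius (hg : 2 ≤ g) {q : Base g} {x' : ℂ} (hx : cx q.1 = scaleX g 1 * x')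
    (h : ‖x' - eoCenter g‖ < eoRadP g (1 / 2) ∨ eoRadP g (-(1 / 2)) < ‖x' - eoCenter g‖) :
    q ∉ eoChart hg '' (univ ×ˢ Icc (-(1 / 2) : ℝ) (1 / 2)) := by
  rintro ⟨p, ⟨-, hp⟩, rfl⟩
  have e : x' = eoX g p := by
    have : cx (eoChart hg p).1 = scaleX g 1 * eoX g p := by simp [eoAmb]
    exact mul_left_cancel₀ (scaleX_ne_zero (by simp)) (hx.symm.trans this)
  rw [e, norm_eoX_sub_center hg] at h
  have := eoRadP_mem_of_abs_le (g := g) (by omega) hp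
  rcases h with h | h <;> linarith [this.1, this.2]

/-- **(E2)** A point on the OTHER sheet over a point of the radial segment is not a chart point: if
`q = pagePt g 1 (x', s √(x'^{2g+1}+1))` while `eoY x' = −s √(x'^{2g+1}+1)`, `s ≠ 0`, `x'^{2g+1}+1 ≠ 0`,
then `eoChart hg p ≠ q` for all `p`. [folklore] -/
theorem eoChart_ne_of_sheet (hg : 2 ≤ g) {q : Base g} {x' s : ℂ} (hs : s ≠ 0) (hf : x' ^ (2 * g + 1) + 1 ≠ 0)
    (hq : q.1 = pagePt g 1 x' (s * csqrt (x' ^ (2 * g + 1) + 1)))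
    (hY : eoY g x' = -s * csqrt (x' ^ (2 * g + 1) + 1)) (p : ℝ × ℝ) : eoChart hg p ≠ q := fun h => by
  have h' := congrArg (fun z : Base g => z.1) h
  simp only [eoChart_val, eoAmb, hq] at h'
  obtain ⟨hx, hy⟩ := (pagePt_inj (c := (1 : ℂ)) (by simp)).1 h'
  rw [hx, hY] at hy
  have : (2 * s) * csqrt (x' ^ (2 * g + 1) + 1) = 0 := by linear_combination -hy
  rcases mul_eq_zero.1 this with h0 | h0
  · exact hs (by simpa using h0)
  · exact csqrt_ne_zero hf h0

/-! ## §3 The registered form -/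

/-- **Sub-goal `helper_eOne_radial_sign`** (H5-5a of the `e_1`-curve (R-E1CURVE) for node N3a of NF4):
along the radial segment of phase `u` (`e^{2πiu} = eoDir g`) of the annulus chart of the `e_1`-curve,
the explicit sheet `eoY` is `σ √(x^{2g+1} + 1)` (principal root) for ONE sign `σ = ±1`, `r ∈ [−1, 1]`.
[folklore] -/
theorem helper_eOne_radial_sign : ∀ (g : ℕ) (_hg : 2 ≤ g) (u : ℝ), Complex.exp (((2 * Real.pi * u : ℝ) : ℂ) * Complex.I) = Summit.SmoothPoincare4.SmoothPoincare4.Theorems.AcyclicBisectionExists.ModpBraidOrbits.eoDir g → ∃ σ : ℂ, (σ = 1 ∨ σ = -1) ∧ ∀ r ∈ Set.Icc (-1 : ℝ) 1, Summit.SmoothPoincare4.SmoothPoincare4.Theorems.AcyclicBisectionExists.ModpBraidOrbits.eoY g (Summit.SmoothPoincare4.SmoothPoincare4.Theorems.AcyclicBisectionExists.ModpBraidOrbits.eoX g (u, r)) = σ * Literature.Topology.FourManifolds.LefschetzBase.csqrt (Summit.SmoothPoincare4.SmoothPoincare4.Theorems.AcyclicBisectionExists.ModpBraidOrbits.eoX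 g (u, r) ^ (2 * g + 1) + 1) :=
  fun _ hg _ hu => exists_sign_radial hg hu

end Summit.SmoothPoincare4.SmoothPoincare4.Theorems.AcyclicBisectionExists.ModpBraidOrbits

end
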